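import Literature.NumberTheory.LFunctions.FordLemma46Smoothing
import Literature.NumberTheory.LFunctions.ZetaArgHSW
import HarnessLib

/-!
# Lemma 4.7 of Mossinghoff–Trudgian–Yang with the constants its proof yields — unconditionally

Topic `Literature/NumberTheory/LFunctions`, family RH (explicit Vinogradov–Korobov zero-free
regions). Closing file of the work on the named fact
`Literature.NumberTheory.LFunctions.zero_inequality_mossinghoff_trudgian_yang` (MTY Lemma 4.7 for
`P₄₀`, `VinogradovKorobovInputs.lean`). Everything here is PROVED; no named fact, no definition,
no hypothesis smuggled: the one remaining hypothesis (`h45` in the last theorem) is displayed, not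
assumed.

With Ford's Lemma 4.6 proved for every admissible smoothing (`FordL46S.ford_lemma_4_6`,
`FordLemma46Smoothing.lean`) and the Riemann–von Mangoldt formula (3.8) of Hasanalizade–Shen–Wong
proved (`zetaZeroCount_hasanalizade_shen_wong_holds`, `ZetaArgHSW.lean`), the conditional
corollaries of `VinogradovKorobovLemma47.lean` close:

* `zero_inequality_mossinghoff_trudgian_yang_corrected` — **the statement of MTY Lemma 4.7
  verbatim except that the constant `0.213` of its `η⁻²[…]` bracket is replaced by
  `3.777 − 500/1879 = 3.5109…`**, i.e. `zeroInequalityMTYWith (3.777 − 500/1879)`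
  (`zeroInequalityMTYWith 0.213` is the named fact, `zero_inequality_mossinghoff_trudgian_yang_iff_with`),
  with NO hypothesis. This is the corrected form of the named fact (see "On the constants").
* `zero_inequality_mossinghoff_trudgian_yang_explicit` — `zeroInequalityMTYGen 9.862 85.1
  (3.777 − 500/1879)`, no hypothesis: the same inequality with MTY's far-zero constants
  `(5.409, 209.1)` replaced by `(9.862, 85.1)`, obtained from the tree's explicit zero-counting
  theorem `abs_zetaZeroCount_sub_main_le_explicit` (`ZetaArgBacklundExplicit.lean`) instead of (3.8).
* `zero_inequality_mossinghoff_trudgian_yang_corrected_of_hsw` — the first bullet from (3.8) as a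
  hypothesis (kept for users who imported it before (3.8) was a theorem).
* `zero_inequality_mossinghoff_trudgian_yang_of_lemma45` — **the named fact AS PRINTED
  (`0.213`) from MTY Lemma 4.5 as printed (constant `0.479`) ALONE**: every other ingredient of
  the printed proof (Ford's Lemmas 2.2, 3.1–3.4, 4.1, 4.4–4.6, 5.1, §6–§7 kernel facts, MTY
  Lemmas 4.2–4.4, 4.6, (3.2), (3.8)) is a theorem of the tree.

Inputs, all theorems of the tree: Ford's Lemmas 2.2, 3.1–3.4, 4.1, 4.4–4.6 and kernel facts
(`FordZetaDetector.*`, `FordLogZetaIntegralBound.lean`, `FordLemma41.lean`,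
`FordLemma45Contour.lean`, `FordLemma46Smoothing.lean`, `VinogradovKorobovTrigIntegral.lean`,
`VinogradovKorobovKernelFacts.lean`), MTY Lemma 4.5 with constant `3.777` (`mty_lemma_4_5`,
`VinogradovKorobovLemma45.lean`; Ford's (4.2) by the kernel-checked certificate of
`VinogradovKorobovCotBound.lean`), MTY Lemma 4.6 (`FarZeros.mty_lemma_4_6_with` from (3.8),
`FarZeros.mty_lemma_4_6_explicit` from the explicit `N(T)` theorem), (3.8)
(`zetaZeroCount_hasanalizade_shen_wong_holds`), and Ford's §7 assembly
(`zero_inequality_mossinghoff_trudgian_yang_of_detector_bound_gen`, `VinogradovKorobovZeroDetector.lean`).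

## On the constants (why `0.213` is replaced)

The named fact has `0.213 ≥ 0.479 − 1/(2·1.879)` (MTY, proof of Lemma 4.6), where `0.479` is
the constant of MTY Lemma 4.5 = Ford's Lemma 4.2, computed (MTY (4.10); Ford p. 33) as
`(1/0.3758)(1/3.1421 − 0.6914/5)`. The factor `1/3.1421` is `|ζ'/ζ(s + η + iv)| ≤ 1/(3.1421R)`
(Ford (4.1), by his Lemma 3.1 on the line `Re = 1 + 3.1421R`), but it is used as a lower bound
for the LEFT side `−Re ζ'/ζ(s)` of Ford's Lemma 4.1 at `Re s = 1 + 0.6421R`, where Lemma 3.1 gives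
only `1/(0.6421R)`; with the justified bound the same argument yields
`(1/0.3758)(1/0.6421 − 0.6914/5) ≤ 3.777` (`mty_lemma_4_5`), whence `3.777 − 500/1879` here.
By Kronecker's theorem `sup_t Re ζ'/ζ(σ + it) = Σ_p log p/(p^σ + 1) ∼ 1/(σ − 1)` as `σ → 1⁺`, so
no bound of the form `1/(3.1421R)` holds on `Re s = 1 + 0.6421R` uniformly in `R → 0`, and a scan
of Ford's two parameters (`Re s = 1 + aR`, `η = cR`) keeps the honest constant above `2.4`
(census in the unit notes). Whether Lemma 4.5 — hence Lemma 4.7 — holds with the printed constants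
is not decided here; `zero_inequality_mossinghoff_trudgian_yang_of_lemma45` records exactly what
is missing.

## References

* M. J. Mossinghoff, T. S. Trudgian, A. Yang, *Explicit zero-free regions for the Riemann
  zeta-function*, Res. Number Theory 10 (2024), no. 1, Paper No. 11 (arXiv:2212.06867): Lemma 4.7
  (p. 9), Lemmas 4.5–4.6 and (4.10) (p. 8), (3.8). [MossinghoffTrudgianYangRNT2024]
* K. Ford, *Zero-free regions for the Riemann zeta function*, Number Theory for the Millennium II
  (Urbana 2000), A K Peters 2002, 25–56 (arXiv:1910.08205): Lemmas 4.1–4.2 and (4.1)–(4.2)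
  (p. 7 of the arXiv version), Lemmas 4.6, 7.1. [Ford2002Millennium]
* E. Hasanalizade, Q. Shen, P.-J. Wong, *Counting zeros of the Riemann zeta function*, J. Number
  Theory 235 (2022), 219–241, Corollary 1.2. [HasanalizadeShenWong2022]
-/

noncomputable section

open Complex Real

namespace Literature.NumberTheory.LFunctions

/-- **MTY Lemma 4.7 with the constants `(9.862, 85.1, 3.777 − 500/1879)`, unconditionally**
(`zero_inequality_mossinghoff_trudgian_yang_explicit_of_h42` with Ford's Lemma 4.6,
`FordL46S.ford_lemma_4_6`, supplying `h42`). [cite: MossinghoffTrudgianYangRNT2024, Lemma 4.7]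
[cite: Ford2002Millennium, Lemmas 4.6 and 7.1] -/
theorem zero_inequality_mossinghoff_trudgian_yang_explicit :
    zeroInequalityMTYGen 9.862 85.1 (3.777 - 500 / 1879) :=
  zero_inequality_mossinghoff_trudgian_yang_explicit_of_h42
    fun _ _ hA hB hR _ hη hη2 _ _ hf ↦ FordL46S.ford_lemma_4_6 (by linarith) hB hR hη hη2 hf

/-- **MTY Lemma 4.7 with only the Lemma-4.5/4.6 constant corrected, from (3.8) as a hypothesis**:
`zetaZeroCount_hasanalizade_shen_wong → zeroInequalityMTYWith (3.777 − 500/1879)`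
(`zero_inequality_mossinghoff_trudgian_yang_of_h42` with `FordL46S.ford_lemma_4_6`).
[cite: MossinghoffTrudgianYangRNT2024, Lemma 4.7] -/
theorem zero_inequality_mossinghoff_trudgian_yang_corrected_of_hsw
    (h38 : zetaZeroCount_hasanalizade_shen_wong) :
    zeroInequalityMTYWith (3.777 - 500 / 1879) :=
  zero_inequality_mossinghoff_trudgian_yang_of_h42
    (fun _ _ hA hB hR _ hη hη2 _ _ hf ↦ FordL46S.ford_lemma_4_6 (by linarith) hB hR hη hη2 hf) h38

/-- **Lemma 4.7 of Mossinghoff–Trudgian–Yang, corrected form, unconditionally.** The statement of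
the named fact `zero_inequality_mossinghoff_trudgian_yang` (MTY Lemma 4.7 for `P₄₀`: for all
`A > 6.5`, `B > 0` with the Richert bound (3.1), every angle `θ` solving (4.1), `0 < η ≤ 1/4`,
`R ≥ 3`, every zero `β + it` of `ζ` with `t ≥ 10⁴` and `1 − β ≤ η/2`, every
`0 < λ ≤ min(1 − β, η/(R+1))` with no zeros in `1 − λ < Re s ≤ 1`, `t − 1 ≤ Im s ≤ 40t + 1`:
`λ⁻¹(cos²θ − (|W'(0)|b₁/(w(0)b₀))((1−β)/λ − 1)) ≤ 0.087π²(b₁/b₀)(1−β)/η² + (2η)⁻¹{(b/b₀)((2/3)L₂ +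
Bη^{3/2}L₁ + log A) + log ζ(1+η)} + C₅(R)(b/b₀)λ{L₁/3 + [5.409 + 5.392B(η^{−1/2} − 2)]L₁ + 209.1 +
η⁻²[(log(A/η) + (2/3)L₂)/1.879 + c]}`) with `c = 3.777 − 500/1879 = 3.5109…` in place of the
printed `c = 0.213`, and no hypothesis. The printed `0.213 = 0.479 − 1/(2·1.879)` inherits the
constant `0.479` of MTY Lemma 4.5, whose printed proof (= Ford's Lemma 4.2) bounds `−Re ζ'/ζ(s)`
at `Re s = 1 + 0.6421R` below by `−1/(3.1421R)`, a bound Ford's Lemma 3.1 gives only on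
`Re s = 1 + 3.1421R`; the justified `−1/(0.6421R)` turns `0.479` into `3.777` (`mty_lemma_4_5`)
and `0.213` into `3.777 − 500/1879` (module docstring, "On the constants"). Proof: the printed
one — `zero_inequality_mossinghoff_trudgian_yang_corrected_of_hsw` (Ford §7 assembly, Ford's
Lemma 4.6, MTY Lemmas 4.4–4.6) with (3.8) now the theorem
`zetaZeroCount_hasanalizade_shen_wong_holds`.
[cite: MossinghoffTrudgianYangRNT2024, Lemma 4.7] [cite: Ford2002Millennium, Lemmas 4.2, 4.6, 7.1] -/
theorem zero_inequality_mossinghoff_trudgian_yang_corrected :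
    zeroInequalityMTYWith (3.777 - 500 / 1879) :=
  zero_inequality_mossinghoff_trudgian_yang_corrected_of_hsw zetaZeroCount_hasanalizade_shen_wong_holds

/-- **The named fact as printed, from MTY Lemma 4.5 as printed alone.**
`zero_inequality_mossinghoff_trudgian_yang` (constant `0.213`) follows from the single hypothesis
`h45` = MTY Lemma 4.5 with its printed constant `0.479` (for every `A > 1`, `B > 0` with (3.1),
`t ≥ 100`, `0 < u ≤ 1/4`: `N(t, u) ≤ 1.3478u^{3/2}B log t + 0.479 + (log A − log u +
(2/3) log log t)/1.879`); everything else in the printed proof is a theorem of the tree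
(`FordL46S.zero_inequality_mossinghoff_trudgian_yang_of_h45` with (3.8) discharged by
`zetaZeroCount_hasanalizade_shen_wong_holds`). `h45` is displayed, not assumed: its printed proof
does not establish it (module docstring), and the tree proves it with `3.777` in place of `0.479`
(`mty_lemma_4_5`). [cite: MossinghoffTrudgianYangRNT2024, Lemmas 4.5 and 4.7] -/
theorem zero_inequality_mossinghoff_trudgian_yang_of_lemma45
    (h45 : ∀ A B : ℝ, 1 < A → 0 < B → RichertBound A B → ∀ t u : ℝ, 100 ≤ t → 0 < u → u ≤ 1 / 4 →
      fordN t u ≤ 1.3478 * u ^ (3 / 2 : ℝ) * B * Real.log t + 0.479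
        + (Real.log A - Real.log u + 2 / 3 * Real.log (Real.log t)) / 1.879) :
    zero_inequality_mossinghoff_trudgian_yang :=
  FordL46S.zero_inequality_mossinghoff_trudgian_yang_of_h45 h45 zetaZeroCount_hasanalizade_shen_wong_holds

end Literature.NumberTheory.LFunctions
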